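/-
Copyright: the b2b-balaban T⁴-continuum CRUX team, row NE7b leaf lineage `t4-ne7b-formalise-leaf-03` (gen 152). Project licence.
-/
import Literature.MathematicalPhysics.QuantumFieldTheory.Balaban1983to89.B5Hk165L2Zd
import Literature.MathematicalPhysics.QuantumFieldTheory.Balaban1983to89.B5Hk165TranslZd

/-!
# THE SUP → SUP ONE-SHOT CHART CONSTANT *IS* THE LARGEST ROW SUM `max_τ Σ′_y |H(chart n 0 τ, y)|` — attained by the sign pattern of a row,
# a finite maximum over the `(n+1)^d` offsets of one block (row NE7b, node U5c; [folklore]; nothing of Bałaban's)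

Cell `pub-balaban`, sub-cell `t4`, spine estimate NE7b (`T4WeightBudget.RelWeightBound`; the cell's OWN estimate — NOT PRINTED in
[Bałaban 1983–89], NOT PROVED).  Crux-route work under `Spine/NE7b/` by leaf-03 (CRUX team (2), FREEZE (0) crux-prover clause, gen 152) —
the SUP-currency companion of this lineage's `OneShotChartFibreSharp` (the η-ℓ² constant IS `sup_{BZ}Σ_kU_kR_k²∕X²`).  NOTHING of Bałaban's is
asserted; no `T4Continuum/Support` leaf; no `def`; zero `sorry`.  Used BY NAME: `B5Hk165L2Zd.HBZd` ∕ `abs_kerH_row` (row `ℓ¹` summability), `B5Hk103ScalarZd.tsum_kerH_row` (`H·1 = 1`), `B5Hk165TranslZd.kerH_translate` ∕ `chart_add` ∕ `bshift` (block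
translation covariance of `H`), `B6QGQLower276.chart_blk_locFin`.

WHY.  PRICING-NE7b v122 F721 ∕ F727 values the pure-sup chart constant `‖H_M‖_{∞→∞}` of the free one-shot section (`2.546 ∕ 3.293 ∕ 3.674 ∕ … → 4.45`
at `M = 2, 3, 4, …`, d = 4) and concludes «sup FAILS at M = 2, 3» BY VALUE; the OWNER's (46) gives `‖H_M‖_{∞→∞} ≤ C_∞(d,a)` with an existential
constant and the floor `1` (`one_le_tsum_abs_kerH`; this file imports Literature only, so that it elaborates while (46)'s hub
olean is pending — (46)'s lemmas are re-derived inline where needed, not restated).  This file types the EXACT characterisation: the sup letter holds with constant `K` iff every row sum `Σ′_y|H(z,y)|`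
is `≤ K`, iff the `(n+1)^d` row sums at the offsets of ONE block are `≤ K` (block periodicity) — so the desk's numbers are statements about
finitely many explicit absolutely convergent series, and ONE certified row sum above a threshold is a kernel refutation of the pure-sup letter
at that side (the sign pattern of that row is the witness).

WHAT IS PROVED ([folklore]; `n : ℕ` the mesh — block side `n+1` —, `a > 0`, every `d`):
* §1 `HBZd_signRow` (`(H·sign H(z,·))(z) = Σ′_y|H(z,y)|`; `|sign| ≤ 1` is the tree's `BMOInv.abs_real_sign_le_one`, used inline), `abs_HBZd_le_rowSum` (`|(HB)(z)| ≤ R·Σ′_y|H(z,y)|` for `|B| ≤ R`).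
* §2 **`sup_letter_iff`**: `(∀ B R, |B| ≤ R ⇒ ∀ z, |(HB)(z)| ≤ K·R) ↔ (∀ z, Σ′_y|H(z,y)| ≤ K)` (the shape of (46) `abs_HBZd_le_sup`);
  **`sup_letter_iff_windows`** (finite windows `HB n a T B`, `|B| ≤ 1`).
* §3 `tsum_abs_kerH_translate` (row sums are block-periodic), `eq_chart_zero_add_bshift`, **`rowSum_le_iff_offsets`** and
  **`sup_letter_iff_offsets`**: the letter ⟺ `∀ τ : Fin d → Fin (n+1), Σ′_y|H(chart n 0 τ, y)| ≤ K` — a FINITE maximum of `(n+1)^d` row sums.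
* §4 `one_le_of_sup_letter` (floor), **`not_sup_letter_of_rowSum_gt`** (one offset with `Σ′_y|H(chart n 0 τ, y)| > K` refutes the letter with
  `K`), `signRow_witness`, `summable_HBZd_signRow`.

NOT HERE (honest): the VALUES of the row sums (a calc enclosure; desk truth `2.546` at `M = 2`, d = 4 — not certified here); the mixed currency
of record (`…OneShotChartMixedNorm`, `…BlockPropagatorMixedNorm`); the torus; anything of Bałaban's ((A3), NC-NE7b-α UNRULED).  BY-NAME EFFECT ON
THE WALL: NONE.  NE7b NOT PRINTED ∕ NOT PROVED; spine PROVED 0∕9; rung (B)+1 on a FINITE torus — NOT infinite volume, NOT the mass gap, NOT Clay.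
HONEST DEPENDENCY: continuum YM on T⁴ ⇐ BetaPertH ∧ nine spine estimates (0∕9 proved); BetaPertH ⇐ (D1) ∧ (D4) ∧ CAP+tail; G-an2-4 gates asym,
D1 and NE2∕3∕4.
-/

set_option autoImplicit false

namespace Summit.QuantumFields.BalabanUV.T4Continuum.NE7b.OneShotChartSupSharp

open Finset
open Literature.MathematicalPhysics.QuantumFieldTheory.Balaban1983to89
open B6QGQLower276 (X B blk chart locFin chart_blk_locFin)
open B5Hk103ScalarZd (kerH)
open B5Hk103Minimizer (HB)
open B5Hk165L2Zd (HBZd)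
open B5Hk165TranslZd (bshift chart_add kerH_translate)
open B5Hk103ScalarZd (tsum_kerH_row)
open B5Hk165L2Zd (abs_kerH_row)

noncomputable section

variable {d : ℕ}

/-! ## §1. The sign pattern of a row attains the row sum -/

/-- **THE SIGN PATTERN OF ROW `z` ATTAINS ITS `ℓ¹`-MASS AT `z`**: `(H·sign H(z,·))(z) = Σ′_y |H(z,y)|`. [folklore] -/
theorem HBZd_signRow (n : ℕ) (a : ℝ) (z : X d) :
    HBZd n a (fun y => Real.sign (kerH n a z y)) z = ∑' y : X d, |kerH n a z y| := by
  unfold HBZd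
  refine tsum_congr fun y => ?_
  show Real.sign (kerH n a z y) * kerH n a z y = |kerH n a z y|
  rcases lt_trichotomy (kerH n a z y) 0 with h | h | h
  · rw [Real.sign_of_neg h, abs_of_neg h]; ring
  · rw [h]; simp
  · rw [Real.sign_of_pos h, abs_of_pos h]; ring

/-- the absolute row bound: `|(HB)(z)| ≤ R·Σ′_y|H(z,y)|` for `|B| ≤ R` (every `d`, every mesh). [folklore] -/
theorem abs_HBZd_le_rowSum (n : ℕ) {a : ℝ} (ha : 0 < a) {Bf : X d → ℝ} {R : ℝ} (hB : ∀ y, |Bf y| ≤ R) (z : X d) :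
    |HBZd n a Bf z| ≤ R * ∑' y : X d, |kerH n a z y| := by
  have hsum : HasSum (fun y : X d => R * |kerH n a z y|) (R * ∑' y : X d, |kerH n a z y|) :=
    (abs_kerH_row n ha z).1.hasSum.mul_left R
  have h := tsum_of_norm_bounded hsum fun y => by
    rw [Real.norm_eq_abs, abs_mul]
    exact mul_le_mul_of_nonneg_right (hB y) (abs_nonneg _)
  rw [Real.norm_eq_abs] at h
  exact h

/-! ## §2. THE SUP LETTER HOLDS WITH CONSTANT `K` IFF EVERY ROW SUM IS `≤ K` -/

/-- **THE SUP → SUP CHART CONSTANT IS `sup_z Σ′_y|H(z,y)|`, EXACTLY** (`ℓ^∞` data on all of `ℤ^d`; the shape of the OWNER's (46)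
`abs_HBZd_le_sup`): `(∀ B R, |B| ≤ R ⇒ ∀ z, |(HB)(z)| ≤ K·R) ↔ (∀ z, Σ′_y |H(z,y)| ≤ K)`. [folklore] -/
theorem sup_letter_iff (n : ℕ) {a : ℝ} (ha : 0 < a) (K : ℝ) :
    (∀ (Bf : X d → ℝ) (R : ℝ), (∀ y, |Bf y| ≤ R) → ∀ z : X d, |HBZd n a Bf z| ≤ K * R)
      ↔ ∀ z : X d, ∑' y : X d, |kerH n a z y| ≤ K := by
  constructor
  · intro h z
    have h1 := h (fun y => Real.sign (kerH n a z y)) 1 (fun y => (by unfold Real.sign; split_ifs <;> norm_num)) z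
    rw [HBZd_signRow, mul_one, abs_of_nonneg (tsum_nonneg fun y => abs_nonneg _)] at h1
    exact h1
  · intro h Bf R hB z
    have hR : 0 ≤ R := (abs_nonneg _).trans (hB 0)
    calc |HBZd n a Bf z| ≤ R * ∑' y : X d, |kerH n a z y| := abs_HBZd_le_rowSum n ha hB z
      _ ≤ R * K := mul_le_mul_of_nonneg_left (h z) hR
      _ = K * R := mul_comm _ _

/-- **finite windows** (the shape used by the η-ℓ² files, `HB n a T B`): `(∀ T B, |B| ≤ 1 ⇒ ∀ z, |Σ_{y∈T}B(y)H(z,y)| ≤ K) ↔ (∀ z, Σ′_y|H(z,y)| ≤ K)`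
— the `→` direction tests the sign pattern on growing windows. [folklore] -/
theorem sup_letter_iff_windows (n : ℕ) {a : ℝ} (ha : 0 < a) (K : ℝ) :
    (∀ (T : Finset (X d)) (Bf : X d → ℝ), (∀ y, |Bf y| ≤ 1) → ∀ z : X d, |HB n a T Bf z| ≤ K)
      ↔ ∀ z : X d, ∑' y : X d, |kerH n a z y| ≤ K := by
  constructor
  · intro h z
    refine (abs_kerH_row n ha z).1.tsum_le_of_sum_le fun T => ?_
    have h1 := h T (fun y => Real.sign (kerH n a z y)) (fun y => (by unfold Real.sign; split_ifs <;> norm_num)) z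
    have h2 : HB n a T (fun y => Real.sign (kerH n a z y)) z = ∑ y ∈ T, |kerH n a z y| := by
      unfold HB
      refine Finset.sum_congr rfl fun y _ => ?_
      show Real.sign (kerH n a z y) * kerH n a z y = |kerH n a z y|
      rcases lt_trichotomy (kerH n a z y) 0 with h | h | h
      · rw [Real.sign_of_neg h, abs_of_neg h]; ring
      · rw [h]; simp
      · rw [Real.sign_of_pos h, abs_of_pos h]; ring
    rw [h2, abs_of_nonneg (Finset.sum_nonneg fun y _ => abs_nonneg _)] at h1
    exact h1
  · intro h T Bf hB z
    unfold HB
    calc |∑ y ∈ T, Bf y * kerH n a z y| ≤ ∑ y ∈ T, |Bf y * kerH n a z y| := Finset.abs_sum_le_sum_abs _ _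
      _ ≤ ∑ y ∈ T, |kerH n a z y| := Finset.sum_le_sum fun y _ => by
          rw [abs_mul]
          exact mul_le_of_le_one_left (abs_nonneg _) (hB y)
      _ ≤ ∑' y : X d, |kerH n a z y| := (abs_kerH_row n ha z).1.sum_le_tsum T fun y _ => abs_nonneg _
      _ ≤ K := h z

/-! ## §3. Block periodicity: the constant is a FINITE maximum over the `(n+1)^d` offsets of one block -/

/-- **row sums are block-periodic**: `Σ′_y |H(z + (n+1)t, y)| = Σ′_y |H(z, y)|` (translation covariance `B5Hk165TranslZd.kerH_translate`). [folklore] -/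
theorem tsum_abs_kerH_translate (n : ℕ) {a : ℝ} (ha : 0 < a) (z t : X d) :
    ∑' y : X d, |kerH n a (z + bshift n t) y| = ∑' y : X d, |kerH n a z y| := by
  rw [← (Equiv.addRight t).tsum_eq (fun y => |kerH n a (z + bshift n t) y|)]
  exact tsum_congr fun y => by rw [Equiv.coe_addRight, kerH_translate n ha z y t]

/-- every fine site is an offset of the zero block shifted by a block vector. [folklore] -/
theorem eq_chart_zero_add_bshift (n : ℕ) (z : X d) : z = chart n 0 (locFin n z) + bshift n (blk n z) := by
  conv_lhs => rw [← chart_blk_locFin n z]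
  rw [← chart_add, zero_add]

/-- **THE SUP CONSTANT IS A FINITE MAXIMUM**: `(∀ z, Σ′_y|H(z,y)| ≤ K) ↔ (∀ τ, Σ′_y|H(chart n 0 τ, y)| ≤ K)` — `(n+1)^d` explicit absolutely
convergent row sums decide the pure-sup chart letter of side `n+1` (what a calc seat encloses). [folklore] -/
theorem rowSum_le_iff_offsets (n : ℕ) {a : ℝ} (ha : 0 < a) (K : ℝ) :
    (∀ z : X d, ∑' y : X d, |kerH n a z y| ≤ K) ↔ ∀ τ : Fin d → Fin (n + 1), ∑' y : X d, |kerH n a (chart n 0 τ) y| ≤ K := by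
  constructor
  · exact fun h τ => h _
  · intro h z
    rw [eq_chart_zero_add_bshift n z, tsum_abs_kerH_translate n ha]
    exact h _

/-- **THE SUP LETTER ⟺ THE `(n+1)^d` OFFSET ROW SUMS ARE `≤ K`**. [folklore] -/
theorem sup_letter_iff_offsets (n : ℕ) {a : ℝ} (ha : 0 < a) (K : ℝ) :
    (∀ (Bf : X d → ℝ) (R : ℝ), (∀ y, |Bf y| ≤ R) → ∀ z : X d, |HBZd n a Bf z| ≤ K * R)
      ↔ ∀ τ : Fin d → Fin (n + 1), ∑' y : X d, |kerH n a (chart n 0 τ) y| ≤ K :=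
  (sup_letter_iff n ha K).trans (rowSum_le_iff_offsets n ha K)

/-! ## §4. Consequences: the floor `K ≥ 1`, and ONE large row sum refutes the letter -/

/-- **FLOOR**: any constant in the sup letter is `≥ 1` — test the constant field `B ≡ 1` (`H·1 = 1`, `B5Hk103ScalarZd.tsum_kerH_row`;
cf. the OWNER's (46) `one_le_tsum_abs_kerH`). [folklore] -/
theorem one_le_of_sup_letter (n : ℕ) {a : ℝ} (ha : 0 < a) {K : ℝ}
    (h : ∀ (Bf : X d → ℝ) (R : ℝ), (∀ y, |Bf y| ≤ R) → ∀ z : X d, |HBZd n a Bf z| ≤ K * R) : 1 ≤ K := by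
  have h1 := h (fun _ => (1 : ℝ)) 1 (fun _ => by simp) 0
  have hH : HBZd n a (fun _ => (1 : ℝ)) (0 : X d) = 1 := by
    unfold HBZd; simp_rw [one_mul]; exact tsum_kerH_row n ha 0
  rw [hH, mul_one] at h1
  simpa using h1

/-- **ONE CERTIFIED ROW SUM ABOVE THE THRESHOLD KILLS THE PURE-SUP LETTER AT THAT SIDE**: if `K < Σ′_y |H(chart n 0 τ, y)|` for some
offset `τ`, then the sup letter with constant `K` fails — witnessed by the sign pattern of that row (the kernel form of the pricing desk's
«‖H_M‖_{∞→∞} = 2.546 > 2 at M = 2, d = 4 ⇒ pure sup FAILS», once a calc seat encloses one row sum from below). [folklore] -/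
theorem not_sup_letter_of_rowSum_gt (n : ℕ) {a : ℝ} (ha : 0 < a) {K : ℝ} (τ : Fin d → Fin (n + 1))
    (hτ : K < ∑' y : X d, |kerH n a (chart n 0 τ) y|) :
    ¬ ∀ (Bf : X d → ℝ) (R : ℝ), (∀ y, |Bf y| ≤ R) → ∀ z : X d, |HBZd n a Bf z| ≤ K * R := fun h =>
  absurd ((sup_letter_iff_offsets n ha K).mp h τ) (not_le.mpr hτ)

/-- the explicit refuting field: `B = sign H(chart n 0 τ, ·)` has `|B| ≤ 1` and `(HB)(chart n 0 τ) = Σ′_y|H(chart n 0 τ, y)|`. [folklore] -/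
theorem signRow_witness (n : ℕ) (a : ℝ) (τ : Fin d → Fin (n + 1)) :
    (∀ y, |Real.sign (kerH n a (chart n 0 τ) y)| ≤ 1) ∧
      HBZd n a (fun y => Real.sign (kerH n a (chart n 0 τ) y)) (chart n 0 τ) = ∑' y : X d, |kerH n a (chart n 0 τ) y| :=
  ⟨fun _ => (by unfold Real.sign; split_ifs <;> norm_num), HBZd_signRow n a _⟩

/-- the `ℓ^∞` action on the sign pattern converges absolutely (rows of `H` are `ℓ¹`, `B5Hk165L2Zd.abs_kerH_row`). [folklore] -/
theorem summable_HBZd_signRow (n : ℕ) {a : ℝ} (ha : 0 < a) (z p : X d) :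
    Summable fun y : X d => Real.sign (kerH n a z y) * kerH n a p y := by
  refine Summable.of_norm_bounded (abs_kerH_row n ha p).1 fun y => ?_
  rw [Real.norm_eq_abs, abs_mul]
  exact mul_le_of_le_one_left (abs_nonneg _) (by unfold Real.sign; split_ifs <;> norm_num)

end

end Summit.QuantumFields.BalabanUV.T4Continuum.NE7b.OneShotChartSupSharp
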